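import Summits.QuantumFields.BalabanUV.Beta.FP.InverseSymbolDeriv
import Summits.QuantumFields.BalabanUV.Beta.FP.GradedIteratedDeriv

/-!
# `BalabanUV.Beta.FP.InverseSymbolDerivN` — road «FP» for binder row D1, leaf H2-P of the horizontal route, row H2-P-INV AT EVERY ORDER («H2-P-INV-N»):
# the `iteratedDeriv` chain of `t ↦ (A t)⁻¹` for a curve in a complete normed algebra (`Ring.inverse`; matrices `A(t)⁻¹`, scalars `(f t)⁻¹`) that is `C^N`
# at `t` with `A(t)` a unit — smoothness, the LEIBNIZ RECURSION `(A⁻¹)^{(n+1)} = −A⁻¹·Σ_{j ≤ n} C(n+1, j+1)·A^{(j+1)}·(A⁻¹)^{(n−j)}`, and the GRADED LETTERS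
# `‖(A⁻¹)^{(n)}(t)‖ ≤ c₀·K^n ∕ r^{n+2}` for EVERY `n ≤ N` from `‖A(t)⁻¹‖ ≤ c₀∕r²`, `‖A^{(i)}(t)‖ ≤ c·r^{2−i}` (`1 ≤ i ≤ N`, ℕ-truncated), `0 < r ≤ R`,
# `K = 1 + 2^N·c₀·c·max(R,1)^N`

HONEST DEPENDENCY (page 1, mandatory): continuum YM on T⁴ ⇐ BetaPertH ∧ nine spine estimates (0/9 proved); BetaPertH ⇐ (D1) ∧ (D4) ∧ CAP+tail;
G-an2-4 gates asym, D1 and NE2/3/4.  HONEST FRAMING (cell contract, verbatim): «discharging `BetaPertH` makes Bałaban's UV stability UNCONDITIONAL —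
a real constructive-QFT result; it is NOT the continuum limit and NOT the Clay problem.»  THIS MODULE DISCHARGES NOTHING of the wall: [folklore] one-variable
calculus in a complete normed algebra over Mathlib BY NAME (`contDiffAt_ringInverse`, `Units.nhds`, the exact Leibniz formula `iteratedDeriv_mul`,
`Filter.EventuallyEq.iteratedDeriv`, `ContDiffOn.differentiableOn_iteratedDerivWithin`, `ContinuousLinearMap.iteratedFDeriv_comp_left`,
`Matrix.nonsing_inv_eq_ringInverse`, `Ring.inverse_eq_inv'`) in the `L∞`-operator-norm currency of `FP/InverseSymbolDeriv` (p234411) ∕ `GAN24/InverseRate`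
(`open scoped Matrix.Norms.Operator`) for the matrix corollaries, plus the exponent bookkeeping `GradedIteratedDeriv.pow_le_pow_mul_pow` (p234468) BY NAME.
No `def`, no `def … : Prop`, nothing cited, 0 sorry; 0 wall binders; NOT D1, NOT BetaPertH, NOT continuum, NOT Clay.

ABSOLUTE RULE (cell charter, verbatim): «No internally-minted statement may enter as a cited fact. Every hypothesis is either kernel-proved in this package or a
verbatim quotation of a PUBLISHED theorem with page reference. The manuscript(s) under audit are NOT citable for their own disputed steps — they are the thing
under adjudication; programme-internal (2001/route/tribunal) claims are never citable.»

WHY (located finding F-gan24leaf01-g47-1, journal 2026-08-20 l.21182; GAPS § O-gan24leaf01-g47-1).  Row H2-P-KER-ASM's (K2)∕(K3) — `‖Δ_iK_B z‖ ≤ C∕‖z‖∞⁴`,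
`‖Δ_iΔ_jK_B z‖ ≤ C∕‖z‖∞⁵` — cost slice-derivative chains of LENGTH 4 and 5 (`PuncturedCoordDeriv.norm_latticeKernel_le_div_supNorm_pow r`), hence the 4th and
5th slice derivatives of the propagator symbol `PinfSym = feynMat⁻¹` and of the scalar factor `(2ε)⁻¹`; the explicit-member chains (`InverseSymbolDeriv.invD1…3`,
`SliceReciprocalChain.rc0…3`) stop at order 3.  Here the members are `iteratedDeriv n (u ↦ (A u)⁻¹)` themselves: the recursion and the letters hold at EVERY
order; §4∕§5 hand the consumers (`PuncturedCoordDeriv`'s `hder`∕`hcont`, Leibniz products) the pointwise chains for matrices and for scalars.  CURRENCY: `A : ℝ → 𝔸`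
is `ContDiffAt ℝ N` at `t` and `IsUnit (A t)` (matrices: `IsUnit (A t).det`; scalars: `f t ≠ 0`); every conclusion is AT `t` (invertibility is open, §1).  WHAT:
* §0 generic: `hasDerivAt_iteratedDeriv_of_contDiffAt` (`ContDiffAt ℝ N g t`, `m < N` ⟹ `HasDerivAt (iteratedDeriv m g) (iteratedDeriv (m+1) g t) t`),
  `continuousAt_iteratedDeriv_of_contDiffAt` (`m ≤ N`), `iteratedDeriv_clm_apply` (a continuous linear functional commutes with `iteratedDeriv`).
* §1 (complete normed algebra `𝔸`) `contDiffAt_inverse`, `eventually_isUnit`.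
* §2 **`sum_leibniz_inverse_eq_zero`** (`Σ_{i ≤ n} C(n,i)·A^{(i)}(t)·(A⁻¹)^{(n−i)}(t) = 0`, `1 ≤ n`) and THE RECURSION **`iteratedDeriv_inverse_succ`**.
* §3 **`norm_iteratedDeriv_inverse_le`**: the graded letters at every order `n ≤ N` (strong induction on the recursion).
* §4 MATRICES (`A(t)⁻¹`, `IsUnit (A t).det`): `contDiffAt_matrix_of_entries` (entrywise `C^N` ⟹ matrix `C^N`), `contDiffAt_matrix_inv`, `iteratedDeriv_matrix_inv_succ`, **`norm_iteratedDeriv_matrix_inv_le`** + entrywise exit, the chain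
  `hasDerivAt_iteratedDeriv_matrix_inv` (`m < N`) + entrywise, `continuousAt_iteratedDeriv_matrix_inv`, `iteratedDeriv_apply_entry` (entries commute with `iteratedDeriv`
  — the bridge to the per-entry currency of `MaxwellSymbolDeriv` ∕ `RemainderSymbolSlice`), `iteratedDeriv_one∕two∕three_matrix_inv` (orders 1–3 = the explicit members `invD1∕invD2∕invD3` of `FP/InverseSymbolDeriv` — consistency).
* §5 SCALARS (`(f t)⁻¹`, `f t ≠ 0`, `f : ℝ → ℝ`): `contDiffAt_inv_real`, **`norm_iteratedDeriv_inv_real_le`**, `hasDerivAt_iteratedDeriv_inv_real`.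
Provenance: G-an2-4 swarm leaf prover 01, gen 47 (prover-b2b-balaban-gan24-formalise-leaf-01-g47-0), road FP «H2-P-INV-N» (owner GO R-FP-21 (B2)), 2026-08-20. NOT IN PRINT.
-/

noncomputable section

namespace Summit.QuantumFields.BalabanUV.Beta.FP.InverseSymbolDerivN

open scoped Matrix.Norms.Operator BigOperators Topology
open Filter Finset
open Summit.QuantumFields.BalabanUV.Beta.FP.InverseSymbolDeriv (invD1 invD2 invD3 hasDerivAt_inv hasDerivAt_invD1 hasDerivAt_invD2)
open Summit.QuantumFields.BalabanUV.Beta.FP.MatrixInvDeriv (hasDerivAt_entry)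
open Summit.QuantumFields.BalabanUV.Beta.FP.GradedIteratedDeriv (pow_le_pow_mul_pow)
open Summit.QuantumFields.BalabanUV.Beta.GAN24.InverseRate (norm_entry_le)

/-! ## §0 Generic: the pointwise chain of `iteratedDeriv` from `ContDiffAt`; linear functionals -/

section Generic

variable {F : Type*} [NormedAddCommGroup F] [NormedSpace ℝ F] {g : ℝ → F} {t : ℝ} {N m : ℕ}

/-- [folklore] `C^N` at `t` with `m < N` ⟹ the `m`-th iterated derivative has the `(m+1)`-st as its derivative AT `t` (local version of Mathlib's
`ContDiff.differentiable_iteratedDeriv`: `C^N` on an open neighbourhood, `iteratedDerivWithin = iteratedDeriv` there). -/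
theorem hasDerivAt_iteratedDeriv_of_contDiffAt (hg : ContDiffAt ℝ N g t) (hm : m < N) :
    HasDerivAt (iteratedDeriv m g) (iteratedDeriv (m + 1) g t) t := by
  obtain ⟨u, hu_open, htu, hgu⟩ := hg.contDiffOn' le_rfl (by simp)
  rw [show insert t Set.univ ∩ u = u by simp] at hgu
  have hdiff : DifferentiableOn ℝ (iteratedDerivWithin m g u) u :=
    hgu.differentiableOn_iteratedDerivWithin (by exact_mod_cast hm) hu_open.uniqueDiffOn
  have hmem : u ∈ 𝓝 t := hu_open.mem_nhds htu
  have heq : iteratedDerivWithin m g u =ᶠ[𝓝 t] iteratedDeriv m g :=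
    Filter.eventuallyEq_of_mem hmem fun y hy => iteratedDerivWithin_of_isOpen hu_open hy
  have hdAt : DifferentiableAt ℝ (iteratedDeriv m g) t :=
    ((hdiff t htu).differentiableAt hmem).congr_of_eventuallyEq heq.symm
  rw [iteratedDeriv_succ]
  exact hdAt.hasDerivAt

/-- [folklore] `C^N` at `t` with `m ≤ N` ⟹ the `m`-th iterated derivative is continuous AT `t`. -/
theorem continuousAt_iteratedDeriv_of_contDiffAt (hg : ContDiffAt ℝ N g t) (hm : m ≤ N) :
    ContinuousAt (iteratedDeriv m g) t := by
  obtain ⟨u, hu_open, htu, hgu⟩ := hg.contDiffOn' le_rfl (by simp)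
  rw [show insert t Set.univ ∩ u = u by simp] at hgu
  have hcont : ContinuousOn (iteratedDerivWithin m g u) u :=
    hgu.continuousOn_iteratedDerivWithin (by exact_mod_cast hm) hu_open.uniqueDiffOn
  have hmem : u ∈ 𝓝 t := hu_open.mem_nhds htu
  have heq : iteratedDerivWithin m g u =ᶠ[𝓝 t] iteratedDeriv m g :=
    Filter.eventuallyEq_of_mem hmem fun y hy => iteratedDerivWithin_of_isOpen hu_open hy
  exact (hcont.continuousAt hmem).congr heq

/-- [folklore] a continuous linear functional commutes with `iteratedDeriv` at a point of `C^N` regularity (Mathlib `ContinuousLinearMap.iteratedFDeriv_comp_left`). -/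
theorem iteratedDeriv_clm_apply {G : Type*} [NormedAddCommGroup G] [NormedSpace ℝ G] (L : F →L[ℝ] G) (hg : ContDiffAt ℝ N g t) (hm : m ≤ N) :
    iteratedDeriv m (fun u => L (g u)) t = L (iteratedDeriv m g t) := by
  rw [iteratedDeriv_eq_iteratedFDeriv, iteratedDeriv_eq_iteratedFDeriv,
    show (fun u => L (g u)) = L ∘ g from rfl, L.iteratedFDeriv_comp_left hg (by exact_mod_cast hm)]
  rfl

end Generic

/-! ## §1 Smoothness of the inverse at a unit; units are open -/

section Algebra

variable {𝔸 : Type*} [NormedRing 𝔸] [NormedAlgebra ℝ 𝔸] [CompleteSpace 𝔸] {A : ℝ → 𝔸} {t : ℝ}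

/-- [folklore] **THE INVERSE OF A `C^N` CURVE IS `C^N` AT EVERY UNIT** (Mathlib `contDiffAt_ringInverse`; `Ring.inverse` is the total inverse of the algebra). -/
theorem contDiffAt_inverse {N : WithTop ℕ∞} (hA : ContDiffAt ℝ N A t) (hunit : IsUnit (A t)) :
    ContDiffAt ℝ N (fun u => Ring.inverse (A u)) t := by
  obtain ⟨v, hv⟩ := hunit
  have h1 : ContDiffAt ℝ N Ring.inverse (A t) := by rw [← hv]; exact contDiffAt_ringInverse ℝ v
  exact h1.comp t hA

omit [NormedAlgebra ℝ 𝔸] in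
/-- [folklore] units are open: along a curve continuous at `t` with `A t` a unit, `A u` is a unit for `u` near `t` (Mathlib `Units.nhds`). -/
theorem eventually_isUnit (hA : ContinuousAt A t) (hunit : IsUnit (A t)) : ∀ᶠ u in 𝓝 t, IsUnit (A u) := by
  obtain ⟨v, hv⟩ := hunit
  have h : {x : 𝔸 | IsUnit x} ∈ 𝓝 (A t) := by rw [← hv]; exact Units.nhds v
  exact hA.preimage_mem_nhds h

/-! ## §2 The Leibniz identity and the recursion -/

/-- [folklore] **LEIBNIZ FOR `A·A⁻¹ = 1`**: at a point where `A` is `Cⁿ` (`1 ≤ n`) and a unit,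
`Σ_{i ≤ n} C(n,i)·A^{(i)}(t)·(A⁻¹)^{(n−i)}(t) = 0` (Mathlib's exact Leibniz formula `iteratedDeriv_mul` on the product, which is `≡ 1` near `t`). -/
theorem sum_leibniz_inverse_eq_zero {n : ℕ} (hA : ContDiffAt ℝ n A t) (hunit : IsUnit (A t)) (hn : 1 ≤ n) :
    ∑ i ∈ Finset.range (n + 1), (n.choose i : 𝔸) * iteratedDeriv i A t * iteratedDeriv (n - i) (fun u => Ring.inverse (A u)) t = 0 := by
  have hinv := contDiffAt_inverse hA hunit
  have hev : (A * fun u => Ring.inverse (A u)) =ᶠ[𝓝 t] fun _ => (1 : 𝔸) := by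
    filter_upwards [eventually_isUnit hA.continuousAt hunit] with u hu
    exact Ring.mul_inverse_cancel (A u) hu
  have h0 : iteratedDeriv n (A * fun u => Ring.inverse (A u)) t = 0 := by
    rw [(hev.iteratedDeriv n).eq_of_nhds, iteratedDeriv_const]
    have : n ≠ 0 := by omega
    simp [this]
  rw [iteratedDeriv_mul hA hinv] at h0
  exact h0

/-- [our object] **THE RECURSION**: at a point where `A` is `C^{n+1}` and a unit,
`(A⁻¹)^{(n+1)}(t) = −A(t)⁻¹ · Σ_{j ≤ n} C(n+1, j+1)·A^{(j+1)}(t)·(A⁻¹)^{(n−j)}(t)` — every order, no explicit member list. -/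
theorem iteratedDeriv_inverse_succ {n : ℕ} (hA : ContDiffAt ℝ (n + 1 : ℕ) A t) (hunit : IsUnit (A t)) :
    iteratedDeriv (n + 1) (fun u => Ring.inverse (A u)) t
      = -(Ring.inverse (A t) * ∑ j ∈ Finset.range (n + 1),
          ((n + 1).choose (j + 1) : 𝔸) * iteratedDeriv (j + 1) A t * iteratedDeriv (n - j) (fun u => Ring.inverse (A u)) t) := by
  have h := sum_leibniz_inverse_eq_zero hA hunit (Nat.succ_le_succ (Nat.zero_le n))
  rw [Finset.sum_range_succ'] at h
  simp only [Nat.choose_zero_right, Nat.cast_one, one_mul, iteratedDeriv_zero, Nat.sub_zero, Nat.add_sub_add_right] at h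
  have h2 := eq_neg_of_add_eq_zero_right h
  calc iteratedDeriv (n + 1) (fun u => Ring.inverse (A u)) t
      = Ring.inverse (A t) * (A t * iteratedDeriv (n + 1) (fun u => Ring.inverse (A u)) t) := by
        rw [← mul_assoc, Ring.inverse_mul_cancel _ hunit, one_mul]
    _ = _ := by rw [h2, mul_neg]

/-! ## §3 The graded letters at every order -/

omit [NormedAlgebra ℝ 𝔸] [CompleteSpace 𝔸] in
/-- [folklore] the letters force `0 ≤ c₀` (`0 ≤ ‖A⁻¹‖ ≤ c₀∕r²`, `r > 0`). -/
theorem c0_nonneg {c₀ r : ℝ} (hr : 0 < r) (hp : ‖Ring.inverse (A t)‖ ≤ c₀ / r ^ 2) : 0 ≤ c₀ := by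
  have h := (norm_nonneg _).trans hp
  by_contra hc; push Not at hc
  linarith [div_neg_of_neg_of_pos hc (show (0:ℝ) < r ^ 2 by positivity)]

omit [CompleteSpace 𝔸] in
/-- [folklore] … and `0 ≤ c` as soon as one order is present. -/
theorem c_nonneg {c r : ℝ} (hr : 0 < r) {i : ℕ} (hci : ‖iteratedDeriv i A t‖ ≤ c * r ^ (2 - i)) : 0 ≤ c := by
  have h := (norm_nonneg _).trans hci
  by_contra hc; push Not at hc
  linarith [mul_neg_of_neg_of_pos hc (show (0:ℝ) < r ^ (2 - i) by positivity)]

omit [NormedAlgebra ℝ 𝔸] [CompleteSpace 𝔸] in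
/-- [folklore] norm of one Leibniz term: `‖C·Y·Z‖ ≤ C·‖Y‖·‖Z‖` for a natural-number coefficient cast into the algebra. -/
theorem norm_cast_mul_mul_le (k : ℕ) (Y Z : 𝔸) : ‖(k : 𝔸) * Y * Z‖ ≤ k * (‖Y‖ * ‖Z‖) := by
  rw [show (k : 𝔸) * Y * Z = k • (Y * Z) by rw [mul_assoc, ← nsmul_eq_mul]]
  exact norm_nsmul_le.trans (mul_le_mul_of_nonneg_left (norm_mul_le _ _) (Nat.cast_nonneg _))

/-- [folklore] the exponent bookkeeping of one term: for `j ≤ m`, `m + 1 ≤ N`, `0 < r ≤ R`: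
`r^{2−(j+1)} ∕ r^{m−j+2} ≤ max(R,1)^N ∕ r^{m+1}` (`GradedIteratedDeriv.pow_le_pow_mul_pow` BY NAME). -/
theorem pow_ratio_le {r R : ℝ} {N : ℕ} (hr : 0 < r) (hrR : r ≤ R) {j m : ℕ} (hjm : j ≤ m) (hmN : m + 1 ≤ N) :
    r ^ (2 - (j + 1)) / r ^ (m - j + 2) ≤ max R 1 ^ N / r ^ (m + 1) := by
  have hR1 : 1 ≤ max R 1 := le_max_right _ _
  have hrR1 : r ≤ max R 1 := hrR.trans (le_max_left _ _)
  rw [div_le_div_iff₀ (by positivity) (by positivity), ← pow_add]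
  exact pow_le_pow_mul_pow hr.le hrR1 hR1 (e := 2 - (j + 1) + (m + 1)) (e' := m - j + 2) (k := N) (by omega) (by omega)

/-- [folklore] `Σ_{j ≤ m} C(m+1, j+1) ≤ 2^{m+1}`. -/
theorem sum_choose_succ_le (m : ℕ) : ∑ j ∈ Finset.range (m + 1), ((m + 1).choose (j + 1) : ℝ) ≤ 2 ^ (m + 1) := by
  have h : ∑ i ∈ Finset.range (m + 2), ((m + 1).choose i : ℝ) = 2 ^ (m + 1) := by exact_mod_cast Nat.sum_range_choose (m + 1)
  rw [Finset.sum_range_succ'] at h; simp only [Nat.choose_zero_right, Nat.cast_one] at h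
  linarith

/-- [our object] **THE GRADED LETTERS OF THE INVERSE AT EVERY ORDER** (complete normed algebra): `A` `C^N` at `t`, `A(t)` a unit, `0 < r ≤ R`,
`‖A(t)⁻¹‖ ≤ c₀∕r²`, `‖A^{(i)}(t)‖ ≤ c·r^{2−i}` for `1 ≤ i ≤ N` (ℕ-truncated exponent) ⟹ for every `n ≤ N`:
`‖(A⁻¹)^{(n)}(t)‖ ≤ c₀·K^n ∕ r^{n+2}`, `K = 1 + 2^N·c₀·c·max(R,1)^N` — degree `−2−n` at all orders. -/
theorem norm_iteratedDeriv_inverse_le {N : ℕ} {c₀ c r R : ℝ} (hA : ContDiffAt ℝ N A t) (hunit : IsUnit (A t)) (hr : 0 < r) (hrR : r ≤ R)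
    (hp : ‖Ring.inverse (A t)‖ ≤ c₀ / r ^ 2) (hc : ∀ i, 1 ≤ i → i ≤ N → ‖iteratedDeriv i A t‖ ≤ c * r ^ (2 - i)) :
    ∀ n ≤ N, ‖iteratedDeriv n (fun u => Ring.inverse (A u)) t‖ ≤ c₀ * (1 + 2 ^ N * c₀ * c * max R 1 ^ N) ^ n / r ^ (n + 2) := by
  set K : ℝ := 1 + 2 ^ N * c₀ * c * max R 1 ^ N with hK
  have hc0 : 0 ≤ c₀ := c0_nonneg hr hp
  intro n
  induction n using Nat.strong_induction_on with
  | _ n ih =>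
    intro hn
    rcases n with _ | m
    · simpa [iteratedDeriv_zero] using hp
    · have hcn : 0 ≤ c := c_nonneg hr (hc 1 le_rfl (by omega))
      have hR1 : 1 ≤ max R 1 := le_max_right _ _
      have hK1 : 1 ≤ K := by
        have : 0 ≤ 2 ^ N * c₀ * c * max R 1 ^ N := by positivity
        linarith
      have hK0 : 0 ≤ K := zero_le_one.trans hK1
      have hrec := iteratedDeriv_inverse_succ (hA.of_le (by exact_mod_cast hn)) hunit
      rw [hrec, norm_neg]
      have hterm : ∀ j ∈ Finset.range (m + 1),
          ‖((m + 1).choose (j + 1) : 𝔸) * iteratedDeriv (j + 1) A t * iteratedDeriv (m - j) (fun u => Ring.inverse (A u)) t‖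
            ≤ ((m + 1).choose (j + 1) : ℝ) * (c * c₀ * max R 1 ^ N * K ^ m / r ^ (m + 1)) := by
        intro j hj
        have hjm : j ≤ m := Nat.lt_succ_iff.mp (Finset.mem_range.mp hj)
        have hY := hc (j + 1) (by omega) (by omega)
        have hZ := ih (m - j) (by omega) (by omega)
        refine (norm_cast_mul_mul_le _ _ _).trans (mul_le_mul_of_nonneg_left ?_ (Nat.cast_nonneg _))
        have hKpow : K ^ (m - j) ≤ K ^ m := pow_le_pow_right₀ hK1 (Nat.sub_le m j)
        calc ‖iteratedDeriv (j + 1) A t‖ * ‖iteratedDeriv (m - j) (fun u => Ring.inverse (A u)) t‖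
            ≤ (c * r ^ (2 - (j + 1))) * (c₀ * K ^ (m - j) / r ^ (m - j + 2)) :=
              mul_le_mul hY hZ (norm_nonneg _) ((norm_nonneg _).trans hY)
          _ = c * c₀ * K ^ (m - j) * (r ^ (2 - (j + 1)) / r ^ (m - j + 2)) := by ring
          _ ≤ c * c₀ * K ^ m * (max R 1 ^ N / r ^ (m + 1)) := by
              refine mul_le_mul ?_ (pow_ratio_le hr hrR hjm hn) (by positivity) (by positivity)
              exact mul_le_mul_of_nonneg_left hKpow (mul_nonneg hcn hc0)
          _ = c * c₀ * max R 1 ^ N * K ^ m / r ^ (m + 1) := by ring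
      have hsum : ‖∑ j ∈ Finset.range (m + 1),
          ((m + 1).choose (j + 1) : 𝔸) * iteratedDeriv (j + 1) A t * iteratedDeriv (m - j) (fun u => Ring.inverse (A u)) t‖
            ≤ 2 ^ N * (c * c₀ * max R 1 ^ N * K ^ m / r ^ (m + 1)) := by
        refine (norm_sum_le_of_le _ hterm).trans ?_
        rw [← Finset.sum_mul]
        refine mul_le_mul_of_nonneg_right ?_ (by positivity)
        exact (sum_choose_succ_le m).trans (pow_le_pow_right₀ (by norm_num) hn)
      calc ‖Ring.inverse (A t) * ∑ j ∈ Finset.range (m + 1),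
              ((m + 1).choose (j + 1) : 𝔸) * iteratedDeriv (j + 1) A t * iteratedDeriv (m - j) (fun u => Ring.inverse (A u)) t‖
          ≤ ‖Ring.inverse (A t)‖ * ‖∑ j ∈ Finset.range (m + 1),
              ((m + 1).choose (j + 1) : 𝔸) * iteratedDeriv (j + 1) A t * iteratedDeriv (m - j) (fun u => Ring.inverse (A u)) t‖ :=
            norm_mul_le _ _
        _ ≤ (c₀ / r ^ 2) * (2 ^ N * (c * c₀ * max R 1 ^ N * K ^ m / r ^ (m + 1))) :=
            mul_le_mul hp hsum (norm_nonneg _) (by positivity)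
        _ = c₀ * ((2 ^ N * c₀ * c * max R 1 ^ N) * K ^ m) / r ^ (m + 1 + 2) := by
            field_simp
            ring
        _ ≤ c₀ * K ^ (m + 1) / r ^ (m + 1 + 2) := by
            refine div_le_div_of_nonneg_right (mul_le_mul_of_nonneg_left ?_ hc0) (by positivity)
            calc (2 ^ N * c₀ * c * max R 1 ^ N) * K ^ m ≤ K * K ^ m :=
                  mul_le_mul_of_nonneg_right (by rw [hK]; linarith) (pow_nonneg hK0 m)
              _ = K ^ (m + 1) := by ring

end Algebra

/-! ## §4 Matrices: `A(t)⁻¹` with `IsUnit (A t).det` (the currency of `FP/InverseSymbolDeriv`) -/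

section Matrices

variable {ι : Type*} [Fintype ι] [DecidableEq ι] {A : ℝ → Matrix ι ι ℂ} {t : ℝ} {N m : ℕ}

/-- [folklore] the matrix inverse is the algebra inverse (Mathlib `Matrix.nonsing_inv_eq_ringInverse`), as functions of the parameter. -/
theorem matrix_inv_eq_inverse (A : ℝ → Matrix ι ι ℂ) : (fun u => (A u)⁻¹) = fun u => Ring.inverse (A u) := funext fun u => Matrix.nonsing_inv_eq_ringInverse (A u)

/-- [folklore] **ENTRYWISE `C^N` ⟹ MATRIX-VALUED `C^N`** at `t` (`A = Σ (A α β) • single α β 1`; per-entry `MaxwellSymbolDeriv.contDiff_feyn_entry` feeds `hA` here). -/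
theorem contDiffAt_matrix_of_entries {N : WithTop ℕ∞} (h : ∀ α β, ContDiffAt ℝ N (fun u => A u α β) t) : ContDiffAt ℝ N A t := by
  have hdec : ∀ M : Matrix ι ι ℂ, M = ∑ α, ∑ β, M α β • Matrix.single α β (1 : ℂ) := fun M => by
    conv_lhs => rw [Matrix.matrix_eq_sum_single M]
    exact Finset.sum_congr rfl fun α _ => Finset.sum_congr rfl fun β _ => by rw [Matrix.smul_single, smul_eq_mul, mul_one]
  rw [show A = fun u => ∑ α, ∑ β, A u α β • Matrix.single α β (1 : ℂ) from funext fun u => hdec (A u)]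
  exact ContDiffAt.sum fun α _ => ContDiffAt.sum fun β _ => (h α β).smul contDiffAt_const

/-- [folklore] `ContDiffAt ℝ N A t`, `IsUnit (A t).det` ⟹ `ContDiffAt ℝ N (u ↦ (A u)⁻¹) t`. -/
theorem contDiffAt_matrix_inv {N : WithTop ℕ∞} (hA : ContDiffAt ℝ N A t) (hdet : IsUnit (A t).det) :
    ContDiffAt ℝ N (fun u => (A u)⁻¹) t := by
  rw [matrix_inv_eq_inverse]
  exact contDiffAt_inverse hA ((Matrix.isUnit_iff_isUnit_det _).2 hdet)

/-- [our object] THE RECURSION, matrix form. -/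
theorem iteratedDeriv_matrix_inv_succ {n : ℕ} (hA : ContDiffAt ℝ (n + 1 : ℕ) A t) (hdet : IsUnit (A t).det) :
    iteratedDeriv (n + 1) (fun u => (A u)⁻¹) t
      = -((A t)⁻¹ * ∑ j ∈ Finset.range (n + 1),
          ((n + 1).choose (j + 1) : Matrix ι ι ℂ) * iteratedDeriv (j + 1) A t * iteratedDeriv (n - j) (fun u => (A u)⁻¹) t) := by
  rw [matrix_inv_eq_inverse, Matrix.nonsing_inv_eq_ringInverse]
  exact iteratedDeriv_inverse_succ hA ((Matrix.isUnit_iff_isUnit_det _).2 hdet)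

/-- [our object] **THE GRADED LETTERS OF `A(t)⁻¹` AT EVERY ORDER** (`L∞`-operator norm): `ContDiffAt ℝ N A t`, `IsUnit (A t).det`, `0 < r ≤ R`, `‖(A t)⁻¹‖ ≤ c₀∕r²`,
`‖A^{(i)}(t)‖ ≤ c·r^{2−i}` (`1 ≤ i ≤ N`; the currency of `MaxwellSymbolDeriv.graded_feyn_entry` after `InverseRate.norm_le_card_mul` and `iteratedDeriv_apply_entry`)
⟹ `∀ n ≤ N, ‖(A⁻¹)^{(n)}(t)‖ ≤ c₀·(1 + 2^N·c₀·c·max(R,1)^N)^n ∕ r^{n+2}` — orders 4 and 5 included. -/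
theorem norm_iteratedDeriv_matrix_inv_le {c₀ c r R : ℝ} (hA : ContDiffAt ℝ N A t) (hdet : IsUnit (A t).det) (hr : 0 < r) (hrR : r ≤ R)
    (hp : ‖(A t)⁻¹‖ ≤ c₀ / r ^ 2) (hc : ∀ i, 1 ≤ i → i ≤ N → ‖iteratedDeriv i A t‖ ≤ c * r ^ (2 - i)) :
    ∀ n ≤ N, ‖iteratedDeriv n (fun u => (A u)⁻¹) t‖ ≤ c₀ * (1 + 2 ^ N * c₀ * c * max R 1 ^ N) ^ n / r ^ (n + 2) := by
  rw [matrix_inv_eq_inverse]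
  rw [Matrix.nonsing_inv_eq_ringInverse] at hp
  exact norm_iteratedDeriv_inverse_le hA ((Matrix.isUnit_iff_isUnit_det _).2 hdet) hr hrR hp hc

/-- [our object] entrywise exit (`GAN24/InverseRate.norm_entry_le` BY NAME): `‖((A⁻¹)^{(n)}(t)) α β‖ ≤ c₀·K^n ∕ r^{n+2}`. -/
theorem norm_iteratedDeriv_matrix_inv_entry_le {c₀ c r R : ℝ} (hA : ContDiffAt ℝ N A t) (hdet : IsUnit (A t).det) (hr : 0 < r) (hrR : r ≤ R)
    (hp : ‖(A t)⁻¹‖ ≤ c₀ / r ^ 2) (hc : ∀ i, 1 ≤ i → i ≤ N → ‖iteratedDeriv i A t‖ ≤ c * r ^ (2 - i)) {n : ℕ} (hn : n ≤ N) (α β : ι) :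
    ‖iteratedDeriv n (fun u => (A u)⁻¹) t α β‖ ≤ c₀ * (1 + 2 ^ N * c₀ * c * max R 1 ^ N) ^ n / r ^ (n + 2) :=
  (norm_entry_le _ α β).trans (norm_iteratedDeriv_matrix_inv_le hA hdet hr hrR hp hc n hn)

/-- [our object] **THE CHAIN OF `A(t)⁻¹` AT EVERY ORDER**: `m < N` ⟹ `HasDerivAt (iteratedDeriv m (u ↦ (A u)⁻¹)) (iteratedDeriv (m+1) (u ↦ (A u)⁻¹) t) t` (the `hder`
datum of `PuncturedCoordDeriv`, matrix form). -/
theorem hasDerivAt_iteratedDeriv_matrix_inv (hA : ContDiffAt ℝ N A t) (hdet : IsUnit (A t).det) (hm : m < N) :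
    HasDerivAt (iteratedDeriv m (fun u => (A u)⁻¹)) (iteratedDeriv (m + 1) (fun u => (A u)⁻¹) t) t :=
  hasDerivAt_iteratedDeriv_of_contDiffAt (contDiffAt_matrix_inv hA hdet) hm

/-- [our object] … entry by entry (the `hX_j` letters of `SliceLeibnizChain`; `MatrixInvDeriv.hasDerivAt_entry` BY NAME). -/
theorem hasDerivAt_iteratedDeriv_matrix_inv_apply (hA : ContDiffAt ℝ N A t) (hdet : IsUnit (A t).det) (hm : m < N) (α β : ι) :
    HasDerivAt (fun u => iteratedDeriv m (fun v => (A v)⁻¹) u α β) (iteratedDeriv (m + 1) (fun v => (A v)⁻¹) t α β) t :=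
  hasDerivAt_entry (hasDerivAt_iteratedDeriv_matrix_inv hA hdet hm) α β

/-- [our object] continuity of the members AT `t` (the `hcont` datum): `m ≤ N`. -/
theorem continuousAt_iteratedDeriv_matrix_inv (hA : ContDiffAt ℝ N A t) (hdet : IsUnit (A t).det) (hm : m ≤ N) :
    ContinuousAt (iteratedDeriv m (fun u => (A u)⁻¹)) t :=
  continuousAt_iteratedDeriv_of_contDiffAt (contDiffAt_matrix_inv hA hdet) hm

omit [DecidableEq ι] in
/-- [folklore] **ENTRIES COMMUTE WITH `iteratedDeriv`**: `(A^{(m)}(t)) α β = (u ↦ A u α β)^{(m)}(t)` for `A` `C^N` at `t`, `m ≤ N` — the bridge between this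
module's matrix currency and the per-entry currency of `MaxwellSymbolDeriv` ∕ `RemainderSymbolSlice` (entry evaluation is a continuous linear functional). -/
theorem iteratedDeriv_apply_entry (hA : ContDiffAt ℝ N A t) (hm : m ≤ N) (α β : ι) :
    iteratedDeriv m A t α β = iteratedDeriv m (fun u => A u α β) t := by
  set L : Matrix ι ι ℂ →L[ℝ] ℂ := LinearMap.toContinuousLinearMap (Matrix.entryLinearMap ℝ ℂ α β) with hL
  have h := iteratedDeriv_clm_apply L hA hm
  exact h.symm

/-- [folklore] ORDER ONE AGREES WITH THE EXPLICIT MEMBER of `FP/InverseSymbolDeriv`: `(A⁻¹)′(t) = invD1 A (deriv A) t = −A(t)⁻¹·A′(t)·A(t)⁻¹`. -/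
theorem iteratedDeriv_one_matrix_inv (hA : DifferentiableAt ℝ A t) (hdet : IsUnit (A t).det) :
    iteratedDeriv 1 (fun u => (A u)⁻¹) t = invD1 A (deriv A) t := by
  rw [iteratedDeriv_one]; exact (hasDerivAt_inv (A₁ := deriv A) hA.hasDerivAt hdet).deriv

/-- [folklore] invertibility is open along the curve, determinant form. -/
theorem eventually_isUnit_det (hA : ContinuousAt A t) (hdet : IsUnit (A t).det) : ∀ᶠ u in 𝓝 t, IsUnit (A u).det := by
  filter_upwards [eventually_isUnit hA ((Matrix.isUnit_iff_isUnit_det _).2 hdet)] with u hu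
  exact (Matrix.isUnit_iff_isUnit_det _).1 hu

/-- [folklore] ORDER TWO AGREES WITH THE EXPLICIT MEMBER `invD2` of `FP/InverseSymbolDeriv` (`A` `C²` at `t`, `A(t)` invertible):
`(A⁻¹)″(t) = invD2 A A′ A″ t` with `A′ = deriv A`, `A″ = iteratedDeriv 2 A`. -/
theorem iteratedDeriv_two_matrix_inv (hA : ContDiffAt ℝ 2 A t) (hdet : IsUnit (A t).det) :
    iteratedDeriv 2 (fun u => (A u)⁻¹) t = invD2 A (deriv A) (iteratedDeriv 2 A) t := by
  have hev : ∀ᶠ u in 𝓝 t, ContDiffAt ℝ 2 A u := hA.eventually (by simp)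
  have heq : iteratedDeriv 1 (fun v => (A v)⁻¹) =ᶠ[𝓝 t] invD1 A (deriv A) := by
    filter_upwards [hev, eventually_isUnit_det hA.continuousAt hdet] with u hu hu'
    exact iteratedDeriv_one_matrix_inv (hu.differentiableAt (by simp)) hu'
  have h0 : HasDerivAt A (deriv A t) t := (hA.differentiableAt (by simp)).hasDerivAt
  have h1 : HasDerivAt (deriv A) (iteratedDeriv 2 A t) t := by
    have h := hasDerivAt_iteratedDeriv_of_contDiffAt hA (m := 1) (by norm_num)
    rwa [iteratedDeriv_one] at h
  have hD := (hasDerivAt_invD1 h0 h1 hdet).congr_of_eventuallyEq heq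
  rw [show (2 : ℕ) = 1 + 1 from rfl, iteratedDeriv_succ]
  exact hD.deriv

/-- [folklore] ORDER THREE AGREES WITH THE EXPLICIT MEMBER `invD3` (`A` `C³` at `t`, `A(t)` invertible): `(A⁻¹)‴(t) = invD3 A A′ A″ A‴ t`. -/
theorem iteratedDeriv_three_matrix_inv (hA : ContDiffAt ℝ 3 A t) (hdet : IsUnit (A t).det) :
    iteratedDeriv 3 (fun u => (A u)⁻¹) t = invD3 A (deriv A) (iteratedDeriv 2 A) (iteratedDeriv 3 A) t := by
  have hev : ∀ᶠ u in 𝓝 t, ContDiffAt ℝ 3 A u := hA.eventually (by simp)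
  have heq : iteratedDeriv 2 (fun v => (A v)⁻¹) =ᶠ[𝓝 t] invD2 A (deriv A) (iteratedDeriv 2 A) := by
    filter_upwards [hev, eventually_isUnit_det hA.continuousAt hdet] with u hu hu'
    exact iteratedDeriv_two_matrix_inv (hu.of_le (by norm_num)) hu'
  have h0 : HasDerivAt A (deriv A t) t := (hA.differentiableAt (by simp)).hasDerivAt
  have h1 : HasDerivAt (deriv A) (iteratedDeriv 2 A t) t := by
    have h := hasDerivAt_iteratedDeriv_of_contDiffAt hA (m := 1) (by norm_num)
    rwa [iteratedDeriv_one] at h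
  have h2 : HasDerivAt (iteratedDeriv 2 A) (iteratedDeriv 3 A t) t := hasDerivAt_iteratedDeriv_of_contDiffAt hA (m := 2) (by norm_num)
  have hD := (hasDerivAt_invD2 h0 h1 h2 hdet).congr_of_eventuallyEq heq
  rw [show (3 : ℕ) = 2 + 1 from rfl, iteratedDeriv_succ]
  exact hD.deriv

end Matrices

/-! ## §5 Scalars: `(f t)⁻¹` with `f t ≠ 0` (the `(2ε)⁻¹` factor of row H2-P-B at every order) -/

section Scalars

variable {f : ℝ → ℝ} {t : ℝ} {N m : ℕ}

/-- [folklore] the field inverse is the algebra inverse, as functions of the parameter. -/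
theorem real_inv_eq_inverse (f : ℝ → ℝ) : (fun u => (f u)⁻¹) = fun u => Ring.inverse (f u) := funext fun u => (Ring.inverse_eq_inv (f u)).symm

/-- [folklore] `ContDiffAt ℝ N f t`, `f t ≠ 0` ⟹ `ContDiffAt ℝ N (u ↦ (f u)⁻¹) t`. -/
theorem contDiffAt_inv_real {N : WithTop ℕ∞} (hf : ContDiffAt ℝ N f t) (hft : f t ≠ 0) : ContDiffAt ℝ N (fun u => (f u)⁻¹) t := by
  rw [real_inv_eq_inverse]
  exact contDiffAt_inverse hf (isUnit_iff_ne_zero.mpr hft)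

/-- [our object] **THE GRADED LETTERS OF `1∕f` AT EVERY ORDER**: `ContDiffAt ℝ N f t`, `f t ≠ 0`, `0 < r ≤ R`, `|f t|⁻¹ ≤ c₀∕r²` (i.e. `κr² ≤ |f t|` with
`c₀ = κ⁻¹`), `|f^{(i)}(t)| ≤ c·r^{2−i}` (`1 ≤ i ≤ N`) ⟹ `∀ n ≤ N, |(1∕f)^{(n)}(t)| ≤ c₀·(1 + 2^N·c₀·c·max(R,1)^N)^n ∕ r^{n+2}` — the `SliceReciprocalChain` letters
without the order ceiling. -/
theorem norm_iteratedDeriv_inv_real_le {c₀ c r R : ℝ} (hf : ContDiffAt ℝ N f t) (hft : f t ≠ 0) (hr : 0 < r) (hrR : r ≤ R)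
    (hp : ‖(f t)⁻¹‖ ≤ c₀ / r ^ 2) (hc : ∀ i, 1 ≤ i → i ≤ N → ‖iteratedDeriv i f t‖ ≤ c * r ^ (2 - i)) :
    ∀ n ≤ N, ‖iteratedDeriv n (fun u => (f u)⁻¹) t‖ ≤ c₀ * (1 + 2 ^ N * c₀ * c * max R 1 ^ N) ^ n / r ^ (n + 2) := by
  rw [real_inv_eq_inverse]
  rw [← Ring.inverse_eq_inv] at hp
  exact norm_iteratedDeriv_inverse_le hf (isUnit_iff_ne_zero.mpr hft) hr hrR hp hc

/-- [our object] the chain of `1∕f` at every order: `m < N` ⟹ `HasDerivAt (iteratedDeriv m (1∕f)) (iteratedDeriv (m+1) (1∕f) t) t`. -/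
theorem hasDerivAt_iteratedDeriv_inv_real (hf : ContDiffAt ℝ N f t) (hft : f t ≠ 0) (hm : m < N) :
    HasDerivAt (iteratedDeriv m (fun u => (f u)⁻¹)) (iteratedDeriv (m + 1) (fun u => (f u)⁻¹) t) t :=
  hasDerivAt_iteratedDeriv_of_contDiffAt (contDiffAt_inv_real hf hft) hm

end Scalars

end Summit.QuantumFields.BalabanUV.Beta.FP.InverseSymbolDerivN

end
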